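import Mathlib
import Summits.Ventures.DiscreteObjects.MOLS.PairArraySwap

/-!
# Every strength-2 array on four coordinates is the pair array of two orthogonal Latin squares;
# renaming coordinates transports automorphisms

Cell `pub-namedobj`, family SOLS. Framing: lottery ticket; floor = certified bounds/negative ranges.
This closes the last informal gap of the census reduction (FAMILY-SOLS §1): "rename the four
coordinates so that a fixed-point-free involution becomes `(0 1)(2 3)` and read the squares off the
array".

* `sqA T`, `sqB T` — the squares read off a strength-2 array `T ⊆ (Fin 4 → α)`: `sqA T x y` is the
  entry in position `2` of the unique row with entries `x, y` in positions `0, 1` (similarly `sqB`,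
  position `3`); they are Latin, orthogonal, and `pairArray (sqA T) (sqB T) = T`
  (`isLatin_sqA`, `isLatin_sqB`, `orthogonal_sqA_sqB`, `pairArray_sq`).
* `renameArray σ T` — the array with coordinates renamed by `σ : Perm (Fin 4)`; it is again strength 2
  (`isOA2_rename`) and an automorphism `(π, φ)` of `T` becomes the automorphism
  `(σ⁻¹ π σ, φ ∘ σ)` of the renamed array (`isArrayAut_rename`).
* `exists_rename_to_swap0123` — every fixed-point-free involution of `Fin 4` is conjugate to
  `swap0123 = (0 1)(2 3)` (kernel `decide`).
Consequently (`selfOrthogonal_normal_form_of_fpf_involution`): if a strength-2 array on four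
coordinates has an automorphism whose coordinate part is a fixed-point-free involution, then after a
renaming of coordinates it is the pair array of squares `(A, B)` carrying a swap automorphism, and if
that `A` is rigid the self-orthogonal normal form of `PairArraySwap` applies. [MMM 2007] is used
nowhere; it is the source of the rigidity hypotheses at order 10.
-/

namespace Summit.Ventures.DiscreteObjects.MOLS

open Classical

variable {α : Type*}

section squares

variable {T : Set (Fin 4 → α)} (hT : IsOA2 T)
include hT

/-- The unique row of `T` with entries `x, y` in positions `0, 1`. -/
noncomputable def rowOf (x y : α) : Fin 4 → α :=
  Classical.choose (hT 0 1 (by decide) x y)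

/-- the chosen row lies in `T` and has the prescribed first two entries -/
theorem rowOf_spec (x y : α) :
    rowOf hT x y ∈ T ∧ rowOf hT x y 0 = x ∧ rowOf hT x y 1 = y :=
  (Classical.choose_spec (hT 0 1 (by decide) x y)).1

/-- uniqueness: any row of `T` with first two entries `x, y` is `rowOf x y` -/
theorem rowOf_unique {x y : α} {t : Fin 4 → α} (ht : t ∈ T) (h0 : t 0 = x) (h1 : t 1 = y) :
    t = rowOf hT x y :=
  (Classical.choose_spec (hT 0 1 (by decide) x y)).2 t ⟨ht, h0, h1⟩

/-- The `A`-square read off the array: position `2` of the row through `(x, y)`. -/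
noncomputable def sqA (x y : α) : α := rowOf hT x y 2
/-- The `B`-square read off the array: position `3` of the row through `(x, y)`. -/
noncomputable def sqB (x y : α) : α := rowOf hT x y 3

/-- Every row of `T` is the row through its first two entries. -/
theorem eq_rowOf {t : Fin 4 → α} (ht : t ∈ T) : t = rowOf hT (t 0) (t 1) :=
  rowOf_unique hT ht rfl rfl

/-- Two rows of `T` agreeing in two distinct positions are equal. -/
theorem row_eq_of_two {i j : Fin 4} (hij : i ≠ j) {t t' : Fin 4 → α} (ht : t ∈ T) (ht' : t' ∈ T)
    (hi : t i = t' i) (hj : t j = t' j) : t = t' := by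
  obtain ⟨u, -, hu⟩ := hT i j hij (t' i) (t' j)
  exact (hu t ⟨ht, hi, hj⟩).trans (hu t' ⟨ht', rfl, rfl⟩).symm

/-- The row through `(x, y)` written out. -/
theorem rowOf_eq_prow (x y : α) : rowOf hT x y = prow (sqA hT) (sqB hT) x y := by
  obtain ⟨-, h0, h1⟩ := rowOf_spec hT x y
  funext j; fin_cases j
  · exact h0
  · exact h1
  · rfl
  · rfl

/-- **The array is the pair array of the squares read off it.** -/
theorem pairArray_sq : pairArray (sqA hT) (sqB hT) = T := by
  ext t; constructor
  · intro ht
    obtain ⟨x, y, rfl⟩ := mem_pairArray.1 ht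
    rw [← rowOf_eq_prow]; exact (rowOf_spec hT x y).1
  · intro ht
    exact mem_pairArray.2 ⟨t 0, t 1, by rw [← rowOf_eq_prow]; exact eq_rowOf hT ht⟩

/-- `sqA` is a Latin square. -/
theorem isLatin_sqA : IsLatin (sqA hT) := by
  refine ⟨fun x y y' h => ?_, fun y x x' h => ?_⟩
  · -- rows through (x,y) and (x,y') agree in positions 0 and 2
    have e := row_eq_of_two hT (i := 0) (j := 2) (by decide) (rowOf_spec hT x y).1
      (rowOf_spec hT x y').1 (by rw [(rowOf_spec hT x y).2.1, (rowOf_spec hT x y').2.1]) h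
    have := congrFun e 1
    rwa [(rowOf_spec hT x y).2.2, (rowOf_spec hT x y').2.2] at this
  · have e := row_eq_of_two hT (i := 1) (j := 2) (by decide) (rowOf_spec hT x y).1
      (rowOf_spec hT x' y).1 (by rw [(rowOf_spec hT x y).2.2, (rowOf_spec hT x' y).2.2]) h
    have := congrFun e 0
    rwa [(rowOf_spec hT x y).2.1, (rowOf_spec hT x' y).2.1] at this

/-- `sqB` is a Latin square. -/
theorem isLatin_sqB : IsLatin (sqB hT) := by
  refine ⟨fun x y y' h => ?_, fun y x x' h => ?_⟩
  · have e := row_eq_of_two hT (i := 0) (j := 3) (by decide) (rowOf_spec hT x y).1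
      (rowOf_spec hT x y').1 (by rw [(rowOf_spec hT x y).2.1, (rowOf_spec hT x y').2.1]) h
    have := congrFun e 1
    rwa [(rowOf_spec hT x y).2.2, (rowOf_spec hT x y').2.2] at this
  · have e := row_eq_of_two hT (i := 1) (j := 3) (by decide) (rowOf_spec hT x y).1
      (rowOf_spec hT x' y).1 (by rw [(rowOf_spec hT x y).2.2, (rowOf_spec hT x' y).2.2]) h
    have := congrFun e 0
    rwa [(rowOf_spec hT x y).2.1, (rowOf_spec hT x' y).2.1] at this

/-- `sqA ⟂ sqB`. -/
theorem orthogonal_sqA_sqB : Orthogonal (sqA hT) (sqB hT) := by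
  intro x y x' y' ha hb
  have e := row_eq_of_two hT (i := 2) (j := 3) (by decide) (rowOf_spec hT x y).1
    (rowOf_spec hT x' y').1 ha hb
  refine ⟨?_, ?_⟩
  · have := congrFun e 0
    rwa [(rowOf_spec hT x y).2.1, (rowOf_spec hT x' y').2.1] at this
  · have := congrFun e 1
    rwa [(rowOf_spec hT x y).2.2, (rowOf_spec hT x' y').2.2] at this

end squares

section rename

/-- Rename the coordinates of an array by `σ`: the new row reads the old position `σ j` in position `j`. -/
def renameArray (σ : Equiv.Perm (Fin 4)) (T : Set (Fin 4 → α)) : Set (Fin 4 → α) :=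
  {u | (fun j => u (σ.symm j)) ∈ T}

/-- membership in the renamed array -/
theorem mem_renameArray {σ : Equiv.Perm (Fin 4)} {T : Set (Fin 4 → α)} {u : Fin 4 → α} :
    u ∈ renameArray σ T ↔ (fun j => u (σ.symm j)) ∈ T := Iff.rfl

/-- a row of `T` read through `σ` is a row of the renamed array -/
theorem comp_mem_renameArray {σ : Equiv.Perm (Fin 4)} {T : Set (Fin 4 → α)} {t : Fin 4 → α}
    (ht : t ∈ T) : (fun j => t (σ j)) ∈ renameArray σ T := by
  rw [mem_renameArray]; convert ht using 1; funext j; simp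

/-- Renaming coordinates preserves strength 2. -/
theorem isOA2_rename {T : Set (Fin 4 → α)} (hT : IsOA2 T) (σ : Equiv.Perm (Fin 4)) :
    IsOA2 (renameArray σ T) := by
  intro i j hij a b
  have hij' : σ i ≠ σ j := fun h => hij (σ.injective h)
  obtain ⟨t, ⟨ht, hi, hj⟩, huniq⟩ := hT (σ i) (σ j) hij' a b
  refine ⟨fun k => t (σ k), ⟨comp_mem_renameArray ht, hi, hj⟩, ?_⟩
  rintro u ⟨hu, hui, huj⟩
  have := huniq (fun k => u (σ.symm k)) ⟨hu, by simpa using hui, by simpa using huj⟩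
  funext k
  have hk := congrFun this (σ k)
  simpa using hk

/-- An automorphism `(π, φ)` of `T` becomes the automorphism `(σ⁻¹ π σ, φ ∘ σ)` of the renamed array
(one direction of invariance suffices for the applications). -/
theorem arrayAut_rename {T : Set (Fin 4 → α)} {π : Equiv.Perm (Fin 4)} {φ : Fin 4 → Equiv.Perm α}
    (h : ∀ t ∈ T, act π φ t ∈ T) (σ : Equiv.Perm (Fin 4)) :
    ∀ u ∈ renameArray σ T, act (σ⁻¹ * π * σ) (fun j => φ (σ j)) u ∈ renameArray σ T := by
  intro u hu
  rw [mem_renameArray] at hu ⊢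
  have := h _ hu
  convert this using 1
  funext j
  simp [act, Equiv.Perm.mul_def, Equiv.Perm.inv_def]

/-- Every fixed-point-free involution of the four coordinates is conjugate to `swap0123`. -/
theorem exists_rename_to_swap0123 (π : Equiv.Perm (Fin 4)) (h : ∀ i, π i ≠ i) (h2 : π ^ 2 = 1) :
    ∃ σ : Equiv.Perm (Fin 4), σ⁻¹ * π * σ = swap0123 := by
  rcases fin4_fpf_involution_pairs π h h2 with rfl | rfl | rfl
  · exact ⟨1, by decide⟩
  · exact ⟨Equiv.swap 1 2, by decide⟩
  · exact ⟨Equiv.swap 1 3, by decide⟩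

end rename

/-- **The reduction, end to end (modulo rigidity).** Let `T` be a strength-2 array on four coordinates
with an automorphism `(π, φ)` whose coordinate part is a fixed-point-free involution. Then for some
renaming `σ` of the coordinates, the renamed array is the pair array of two orthogonal Latin squares
`A = sqA, B = sqB` carrying a swap automorphism; and if that `A` is rigid (no non-trivial autotopism —
[MMM 2007] at order 10), then `L := swapSquare A (φ (σ 0))` is SELF-ORTHOGONAL and a square is a common
orthogonal mate of `A, B` iff its column relabelling is one of `L, Lᵀ`. -/
theorem selfOrthogonal_normal_form_of_fpf_involution {T : Set (Fin 4 → α)} (hT : IsOA2 T)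
    {π : Equiv.Perm (Fin 4)} {φ : Fin 4 → Equiv.Perm α} (haut : ∀ t ∈ T, act π φ t ∈ T)
    (hfpf : ∀ i, π i ≠ i) (hinv : π ^ 2 = 1) :
    ∃ σ : Equiv.Perm (Fin 4),
      let hT' := isOA2_rename hT σ
      IsSwapAut (sqA hT') (sqB hT') (φ (σ 0)) (φ (σ 1)) (φ (σ 2)) (φ (σ 3)) ∧
      ((∀ r c s : Equiv.Perm α, IsAutotopism (sqA hT') r c s → r = 1 ∧ c = 1 ∧ s = 1) →
        Orthogonal (swapSquare (sqA hT') (φ (σ 0))) (fun x y => swapSquare (sqA hT') (φ (σ 0)) y x) ∧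
        ∀ M : α → α → α, (Orthogonal M (sqA hT') ∧ Orthogonal M (sqB hT')) ↔
          (Orthogonal (fun x y => M x (φ (σ 0) y)) (swapSquare (sqA hT') (φ (σ 0))) ∧
            Orthogonal (fun x y => M x (φ (σ 0) y)) (fun x y => swapSquare (sqA hT') (φ (σ 0)) y x))) := by
  obtain ⟨σ, hσ⟩ := exists_rename_to_swap0123 π hfpf hinv
  refine ⟨σ, ?_⟩
  intro hT'
  have hren := arrayAut_rename haut σ
  rw [hσ] at hren
  -- the renamed array is the pair array of (sqA, sqB)
  have hpa : pairArray (sqA hT') (sqB hT') = renameArray σ T := pairArray_sq hT'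
  have hsw : IsSwapAut (sqA hT') (sqB hT') (φ (σ 0)) (φ (σ 1)) (φ (σ 2)) (φ (σ 3)) := by
    apply isSwapAut_of_arrayAut (φ := fun j => φ (σ j))
    rw [hpa]; exact hren
  refine ⟨hsw, fun rigid => ?_⟩
  obtain ⟨h1, h3⟩ := swapAut_involutive_of_rigid hsw rigid
  rw [h1, h3] at hsw
  exact ⟨selfOrthogonal_of_swapAut (orthogonal_sqA_sqB hT') hsw, fun M => extends_iff_of_swapAut hsw M⟩

end Summit.Ventures.DiscreteObjects.MOLS
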